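import Mathlib
import Summits.Ventures.DiscreteObjects.Mahler.SmallMeasureCensus

/-!
# The Graeffe identity `M(q) = M(p)²` and the full rejection certificate (venture `DiscreteObjects`, target L)

Cell `pub-namedobj`, seat `pub-namedobj-mahler-g2`. Framing: lottery ticket; floor = certified
bounds/negative ranges.

`SmallMeasureCensus.lean` proved the elementary rejection step (`C(n,k)·B < |aₖ| ⇒ B < M(p)`) and NAMED
the Graeffe relation `IsGraeffeIterate p q` (`q(x²) = ± p(x)·p(−x)`, `q` monic of the same degree),
leaving the identity `M(q) = M(p)²` unproved. This file proves it, in Mathlib's vocabulary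
(`Polynomial.mahlerMeasure` over `ℂ`):

* `mahlerMeasure_neg`, `mahlerMeasure_comp_neg_X` (`M(p(−x)) = M(p)`),
  `mahlerMeasure_comp_X_pow_two` (`M(p(x²)) = M(p)`) — from the root factorisation over `ℂ`;
* `intMahlerMeasure_sq_of_isGraeffeIterate` : `IsGraeffeIterate p q → M(q) = M(p)²`;
* `GraeffeChain p m q` (m successive Graeffe steps) and
  `intMahlerMeasure_of_graeffeChain : M(q) = M(p)^(2^m)`;
* the COMPLETE certificate used by the census engines (exact integer arithmetic on the `m`-th
  Graeffe iterate): `lt_intMahlerMeasure_of_graeffeChain` — if `C(n,k)·B^(2^m) < |aₖ(p_m)|` then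
  `B < M(p)`.

So every rejection line `(p, m, k)` emitted by engine A / engine B of the cell's census is now a
statement the kernel can check given the iterates (which are computable from `p`).
-/

namespace Summit.Ventures.DiscreteObjects.Mahler

open Polynomial

/-- `M(−p) = M(p)`. -/
theorem mahlerMeasure_neg (p : ℂ[X]) : (-p).mahlerMeasure = p.mahlerMeasure := by
  rw [show -p = C (-1) * p by simp, mahlerMeasure_mul, mahlerMeasure_const]
  simp

/-- `M(p(−x)) = M(p)`: the roots are negated, the leading coefficient changes at most by a sign. -/
theorem mahlerMeasure_comp_neg_X (p : ℂ[X]) : (p.comp (-X)).mahlerMeasure = p.mahlerMeasure := by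
  have hs := (IsAlgClosed.splits p).eq_prod_roots
  have h1 : (p.comp (-X)).mahlerMeasure =
      ‖p.leadingCoeff‖ * (p.roots.map (fun a ↦ max 1 ‖a‖)).prod := by
    conv_lhs => rw [hs]
    rw [mul_comp, C_comp, multiset_prod_comp, mahlerMeasure_mul, mahlerMeasure_const,
      prod_mahlerMeasure_eq_mahlerMeasure_prod, Multiset.map_map, Multiset.map_map]
    congr 1
    apply congrArg
    apply Multiset.map_congr rfl
    intro a _
    simp only [Function.comp_apply, sub_comp, X_comp, C_comp]
    rw [show (-X - C a : ℂ[X]) = -(X + C a) by ring, mahlerMeasure_neg, mahlerMeasure_X_add_C]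
  rw [h1, mahlerMeasure_eq_leadingCoeff_mul_prod_roots]

/-- For `t ≥ 0`: `max(1,t)·max(1,t) = max(1,t·t)`. -/
theorem max_one_mul_max_one_self {t : ℝ} (ht : 0 ≤ t) : max 1 t * max 1 t = max 1 (t * t) := by
  rcases le_total t 1 with h | h
  · rw [max_eq_left h, max_eq_left (by nlinarith)]
    ring
  · rw [max_eq_right h, max_eq_right (by nlinarith)]

/-- `M(x² − a) = max(1,|a|)`: the roots are `±s` with `s² = a`. -/
theorem mahlerMeasure_X_pow_two_sub_C (a : ℂ) : (X ^ 2 - C a : ℂ[X]).mahlerMeasure = max 1 ‖a‖ := by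
  obtain ⟨s, rfl⟩ := IsAlgClosed.exists_eq_mul_self a
  rw [show (X ^ 2 - C (s * s) : ℂ[X]) = (X - C s) * (X + C s) by rw [map_mul]; ring,
    mahlerMeasure_mul, mahlerMeasure_X_sub_C, mahlerMeasure_X_add_C, norm_mul,
    max_one_mul_max_one_self (norm_nonneg s)]

/-- `M(p(x²)) = M(p)`. -/
theorem mahlerMeasure_comp_X_pow_two (p : ℂ[X]) : (p.comp (X ^ 2)).mahlerMeasure = p.mahlerMeasure := by
  have hs := (IsAlgClosed.splits p).eq_prod_roots
  have h1 : (p.comp (X ^ 2)).mahlerMeasure =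
      ‖p.leadingCoeff‖ * (p.roots.map (fun a ↦ max 1 ‖a‖)).prod := by
    conv_lhs => rw [hs]
    rw [mul_comp, C_comp, multiset_prod_comp, mahlerMeasure_mul, mahlerMeasure_const,
      prod_mahlerMeasure_eq_mahlerMeasure_prod, Multiset.map_map, Multiset.map_map]
    congr 1
    apply congrArg
    apply Multiset.map_congr rfl
    intro a _
    simp only [Function.comp_apply, sub_comp, X_comp, C_comp]
    exact mahlerMeasure_X_pow_two_sub_C a
  rw [h1, mahlerMeasure_eq_leadingCoeff_mul_prod_roots]

/-- `M(−p) = M(p)` for integer polynomials. -/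
theorem intMahlerMeasure_neg (p : ℤ[X]) : intMahlerMeasure (-p) = intMahlerMeasure p := by
  unfold intMahlerMeasure
  rw [Polynomial.map_neg, mahlerMeasure_neg]

/-- `0 ≤ M(p)` for integer polynomials. -/
theorem intMahlerMeasure_nonneg (p : ℤ[X]) : 0 ≤ intMahlerMeasure p := by
  unfold intMahlerMeasure
  exact mahlerMeasure_nonneg _

/-- `M(p(x)·p(−x)) = M(p)²` for integer polynomials. -/
theorem intMahlerMeasure_mul_comp_neg_X (p : ℤ[X]) :
    intMahlerMeasure (p * p.comp (-X)) = intMahlerMeasure p ^ 2 := by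
  unfold intMahlerMeasure
  rw [Polynomial.map_mul, mahlerMeasure_mul, map_comp]
  simp only [Polynomial.map_neg, map_X]
  rw [mahlerMeasure_comp_neg_X, sq]

/-- `M(q(x²)) = M(q)` for integer polynomials. -/
theorem intMahlerMeasure_comp_X_pow_two (q : ℤ[X]) :
    intMahlerMeasure (q.comp (X ^ 2)) = intMahlerMeasure q := by
  unfold intMahlerMeasure
  rw [map_comp]
  simp only [Polynomial.map_pow, map_X]
  exact mahlerMeasure_comp_X_pow_two _

/-- **Graeffe identity.** If `q` is a Graeffe iterate of `p` (`q(x²) = ± p(x)p(−x)`), then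
`M(q) = M(p)²`. (Only the functional equation is used; monicity and the degree condition recorded in
`IsGraeffeIterate` are not needed for the identity.) -/
theorem intMahlerMeasure_sq_of_isGraeffeIterate {p q : ℤ[X]} (h : IsGraeffeIterate p q) :
    intMahlerMeasure q = intMahlerMeasure p ^ 2 := by
  obtain ⟨_, _, h3⟩ := h
  rw [← intMahlerMeasure_comp_X_pow_two q, ← intMahlerMeasure_mul_comp_neg_X p]
  rcases h3 with h3 | h3
  · rw [h3]
  · rw [h3, intMahlerMeasure_neg]

/-- `GraeffeChain p m q`: `q` is obtained from `p` by `m` successive Graeffe steps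
(`p = p₀, p₁, …, p_m = q`, each `IsGraeffeIterate pᵢ pᵢ₊₁`). -/
inductive GraeffeChain : ℤ[X] → ℕ → ℤ[X] → Prop
  /-- zero steps -/
  | refl (p : ℤ[X]) : GraeffeChain p 0 p
  /-- one more Graeffe step at the end -/
  | step {p q r : ℤ[X]} {m : ℕ} : GraeffeChain p m q → IsGraeffeIterate q r → GraeffeChain p (m + 1) r

/-- Along a Graeffe chain of length `m`: `M(p_m) = M(p)^(2^m)`. -/
theorem intMahlerMeasure_of_graeffeChain {p q : ℤ[X]} {m : ℕ} (h : GraeffeChain p m q) :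
    intMahlerMeasure q = intMahlerMeasure p ^ (2 ^ m) := by
  induction h with
  | refl => simp
  | step hc hqr ih =>
    rw [intMahlerMeasure_sq_of_isGraeffeIterate hqr, ih, ← pow_mul, pow_succ]

/-- **The complete rejection certificate of the census engines.** If `p_m` is the `m`-th Graeffe
iterate of `p : ℤ[X]` (any chain of `m` Graeffe steps), `B` is rational and some coefficient of
`p_m` violates Mahler's bound, `C(deg p_m, k)·B^(2^m) < |aₖ(p_m)|`, then `B < M(p)` — decided in exact
integer/rational arithmetic (no sign condition on `B` is needed since `M(p) ≥ 0`). -/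
theorem lt_intMahlerMeasure_of_graeffeChain {p q : ℤ[X]} {m : ℕ} (h : GraeffeChain p m q) (k : ℕ)
    {B : ℚ} (hk : (q.natDegree.choose k : ℚ) * B ^ (2 ^ m) < |(q.coeff k : ℚ)|) :
    (B : ℝ) < intMahlerMeasure p := by
  have h1 := lt_intMahlerMeasure_of_choose_mul_lt_abs_coeff q k hk
  rw [intMahlerMeasure_of_graeffeChain h] at h1
  push_cast at h1
  exact lt_of_pow_lt_pow_left₀ _ (intMahlerMeasure_nonneg p) h1

end Summit.Ventures.DiscreteObjects.Mahler
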